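import Mathlib
import Literature.Computability.AlgebraicComplexity.EquivariantDC
import Summits.ValiantsHypothesis.ValiantsHypothesis.Theorems.RigidityForcesSymmetryRankRigidMinimalReprTiedTorusBoundOneTwo

/-!
# DetQP / crux `DetqpThesis` (stmt-ValiantsHypothesis-0318), line `torus_rung` — the exponential left-torus rung
# `TorusRungExp` FROM the finite statements `LaplaceOptimal d` (`d ≥ 4`)

The line `Cruxes/DetqpThesis/Lines/torus_rung.lean` of the route-of-record DetQP names `TorusRungExp`: «for `m ≥ 3`, every affine
determinantal representation of `per_m` over `ℂ` equivariant (exact `GL × GL` lifts) under the LEFT torus `x ↦ diag(d)·x` has size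
`≥ 2^m - 1`» (Grenet optimal among left-torus-equivariant representations; its registered stub `stub_torusRung` follows from it by the
line's own `torusRung_of_exp`).  The ladder of crux 18034 (`RigidityForcesSymmetry.RankRigidMinimalRepr`, line `PairTiedTorusBound`)
reduces exactly this statement to FINITE combinatorics: `tiedTorusBound_of_laplaceOptimal_ge_four` (`…TiedTorusBoundOneTwo.lean`):
`(∀ d ≥ 4, LaplaceOptimal d) → ∀ k, TiedTorusBound k`, and the left torus is the tied torus with ALL column scalars tied
(`tiedTorus m (m-1) ≤` left torus).  This file records the bridge in the vocabulary of `torus_rung.lean` (its `leftTorusSubst m`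
spelled inline — `Theorems/` cannot import `Cruxes/` — so the line wires `exact`):

* `torusRungExp_of_laplaceOptimal_ge_four : (∀ d ≥ 4, LaplaceOptimal d) → (TorusRungExp, unfolded)`.

CONDITIONAL statement (the hypothesis is explicit; `LaplaceOptimal 4` is border-false, `…LaplaceFourBorder.lean`, and open exactly;
`LaplaceOptimal d` for all `d` is expected to be hard).  HONEST FRAMING: a kernel bridge between two in-tree ladders; nothing is claimed
about the hypothesis; the crux `DetqpThesis` and `TorusRung` stay OPEN; census-neutral; `VP ≠ VNP` is NOT proved.
-/

set_option autoImplicit false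

-- the mandated summit-side namespace repeats a component by design (single-problem summit)
set_option linter.dupNamespace false

open Matrix
open scoped Kronecker
open Literature.Computability.AlgebraicComplexity
open Summit.ValiantsHypothesis.ValiantsHypothesis.Theorems.RigidityForcesSymmetryPairTiedTorusBound
open Summit.ValiantsHypothesis.ValiantsHypothesis.Theorems.RigidityForcesSymmetryRankRigidMinimalRepr

namespace Summit.ValiantsHypothesis.ValiantsHypothesis.Theorems.DetQPDetqpThesis

/-- The tied torus with all columns tied lies in the left torus `{diag(d) ⊗ 1}` (absorb the common column scalar into `d`;
the diagonal entries of an invertible diagonal matrix are non-zero). -/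
theorem tiedTorus_sub_one_le_leftTorus (m : ℕ) :
    tiedTorus m (m - 1) ≤ Subgroup.closure {γ : GL (Fin m × Fin m) ℂ | ∃ d : Fin m → ℂ, (∀ i, d i ≠ 0) ∧
      (γ : Matrix (Fin m × Fin m) (Fin m × Fin m) ℂ) = Matrix.diagonal d ⊗ₖ (1 : Matrix (Fin m) (Fin m) ℂ)} := by
  refine Subgroup.closure_mono ?_
  rintro γ ⟨d, e, he, hγ⟩
  -- the diagonal entries of `γ` are units
  have hne : ∀ p : Fin m × Fin m, d p.1 * e p.2 ≠ 0 := by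
    intro p hp
    have hdet : (γ : Matrix (Fin m × Fin m) (Fin m × Fin m) ℂ).det ≠ 0 :=
      (Matrix.isUnit_iff_isUnit_det _ |>.1 (Units.isUnit γ)).ne_zero
    rw [hγ, Matrix.det_diagonal] at hdet
    exact hdet (Finset.prod_eq_zero (Finset.mem_univ p) hp)
  rcases Nat.eq_zero_or_pos m with rfl | hm
  · refine ⟨fun i => Fin.elim0 i, fun i => Fin.elim0 i, ?_⟩
    rw [hγ]; ext p; exact Fin.elim0 p.1
  · refine ⟨fun k => d k * e ⟨0, hm⟩, fun k => hne (k, ⟨0, hm⟩), ?_⟩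
    rw [hγ, ← Matrix.diagonal_one, Matrix.diagonal_kronecker_diagonal]
    congr 1
    funext p
    rw [mul_one, he p.2 ⟨0, hm⟩ (by have := p.2.isLt; omega) (by omega)]

/-- **`TorusRungExp` from `LaplaceOptimal d`, `d ≥ 4`** (statement of `Cruxes/DetqpThesis/Lines/torus_rung.lean`'s `TorusRungExp`
with `leftTorusSubst m` unfolded): if Laplace expansion is optimal for the permutation pattern of every order `d ≥ 4`, then for
`m ≥ 3` every left-torus-equivariant (exact lifts) affine determinantal representation of `perm_m` over `ℂ` has size `n ≥ 2^m - 1`.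
Bridge `tiedTorusBound_of_laplaceOptimal_ge_four` (all columns tied) + `tiedTorus_sub_one_le_leftTorus`.  Conditional; the
hypothesis is open (border-false at `d = 4`). [cite: LandsbergRessayre2017, Thm. 2.8, Question 2.2] -/
theorem torusRungExp_of_laplaceOptimal_ge_four (hL : ∀ d : ℕ, 4 ≤ d → LaplaceOptimal d) :
    ∀ m : ℕ, 3 ≤ m → ∀ (n : ℕ) (A : Matrix (Fin n) (Fin n) (MvPolynomial (Fin m × Fin m) ℂ)),
      IsEquivariantDetRepr (Subgroup.closure {γ : GL (Fin m × Fin m) ℂ | ∃ d : Fin m → ℂ, (∀ i, d i ≠ 0) ∧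
          (γ : Matrix (Fin m × Fin m) (Fin m × Fin m) ℂ) = Matrix.diagonal d ⊗ₖ (1 : Matrix (Fin m) (Fin m) ℂ)})
        (perPoly (Fin m) ℂ) A →
      2 ^ m - 1 ≤ n :=
  fun m hm n A hA =>
    tiedTorusBound_of_laplaceOptimal_ge_four hL (m - 1) m hm n A (hA.anti (tiedTorus_sub_one_le_leftTorus m))

end Summit.ValiantsHypothesis.ValiantsHypothesis.Theorems.DetQPDetqpThesis
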